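import Mathlib
import Summits.BirchSwinnertonDyer.Rank1Residual.Iwasawa.LambdaInvariantZeros

/-!
# «AC-DEFECT-PRIME» — the anticyclotomic defect prime `π_i = Φ_{p^i}(1 + T_−)` of bstw-MEMO-17 §2

Kernel twin (theorems only; Mathlib + the tree's `Λ = ℤ_p⟦T⟧` vocabulary `IwasawaAlgebra` / `X1.MuLambda.mu`,
`lam`) of the commutative algebra behind G-ledger row **G10** (= I3-(R-s)) of the cell bsd-ssimc's verification of
Burungale–Skinner–Tian–Wan, arXiv:2409.01350, Thm. 1.3 on corner X6 at `p ≥ 5` (crux 2 `KobayashiLowerHalfSemistable`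
of route SignedLowerHalves, S-scoped tier): the clause «structurally LOAD-BEARING for `s(L,p) ≥ 1`» of bstw-MEMO-17
(ed9c91c4af26128b) §2, hand-checked in REPORT-bstw-15 (ask (b)). In the coordinates of BSTW I §3.1.5
(`Λ_L = 𝒪⟦T_+, T_−⟧ ⊃ Λ^cyc = 𝒪⟦T_+⟧`, `1 + T_v = (1 + T_−)²`) the memo argues: a hypothetical defect at the
irregular weight-one prime `P_i = (Φ_{p^i}(1 + T_v))` is `(π_i)`, `π_i := Φ_{p^i}(1 + T_−)`, since
`Φ_{p^i}((1+T_−)²) = Φ_{p^i}(1+T_−)·Φ_{2p^i}(1+T_−)` with the second factor a UNIT; `π_i` is distinguished in `T_−`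
(`μ = 0`, `λ = φ(p^i) > 0`, prime in `Λ^{ac}`) with `(π_i) ∩ Λ^cyc = 0`, so it survives the removal of
`Λ^cyc`-denominators at step S5 (referee c1: NOT inverted in `Λ_L ⊗_{Λ^cyc} Frac Λ^cyc`, correcting the planner's
D29-2 guess), and on the cyclotomic line `T_− = 0` it specialises to `π_i(0) = Φ_{p^i}(1) = p` (the `μ`-type
constant `p^{Σ e_i}`). Model: `R` any commutative ring (the constants `Λ^cyc`; in the tree `R = ℤ_[p]⟦T_+⟧`), the
two-variable algebra realised as the tree's `IwasawaAlgebra₂ p = PowerSeries (IwasawaAlgebra p)` is — power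
series in the OUTER variable `T_−`, so that `T_− = 0` is `PowerSeries.constantCoeff` and `Λ^cyc ↪ Λ_L` is
`PowerSeries.C`; `π_i` is spelled `((cyclotomic (p^(i+1)) R).comp (X+1) : R⟦T⟧)` (index shift `i ↦ i+1`, `i ≥ 0`).
Dictionary: §1 `cyclotomic_comp_X_add_one_sq` ↔ «`Φ(1+T_v) = Φ((1+T_−)²) = π_i · Φ_{2p^i}(1+T_−)`»; §2
`isUnit_coe_cyclotomic_two_mul_comp`, `coe_cyclotomic_comp_sq_eq_mul_unit` ↔ «`Φ_{2p^i}(1+T_−)` a UNIT»,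
«`(Φ_{p^i}(1+T_v)) = (π_i)`»; §3 `cyclotomic_comp_isDistinguishedAt`, `map_cyclotomic_comp_eq_X_pow`,
`constantCoeff_coe_cyclotomic_comp`, `constantCoeff_prod_pow` ↔ «distinguished (Eisenstein)», «`π_i(0) = p`,
`p^{Σe_i}`»; §4 `eq_zero_of_dvd_C` ↔ «`(π_i) ∩ Λ^cyc = 0`» (Weierstrass uniqueness, Mathlib
`IsWeierstrassDivisorAt.eq_zero_of_mul_eq`, under `⋂ₙ pⁿR = 0`); §5 the `ℤ_p⟦T_+⟧⟦T_−⟧` instances; §6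
`not_isUnit_algebraMap_localization` ↔ referee c1; §7 `mu_`/`lam_`/`prime_coe_cyclotomic_comp` ↔ «`μ(π_i) = 0`,
`λ(π_i) = φ(p^i)`, irreducible in `Λ^{ac}`» in the tree's own `(μ, λ)` vocabulary.
WHAT THIS IS NOT: not primality of `(π_i)` in the two-variable `Λ_L`; not the dictionary `(R-s) ↔ P_i` nor anything
about `H_v`, `𝓛_v(L)`, [HT94], [BD21]; no binder, no tier word, no curve. Kernel state of crux 2 (p441716 ⟸
{thm13_scopedS_OPEN, thm13_scopedAtThreeS_OPEN, exists_isNewformOf, diamond1995_refinedSerre}) UNCHANGED; BSD is not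
proved by any of this. Seat bsd-ssimc-k3-c2 g17; `--supports stmt-BirchSwinnertonDyer-19000 --as helper`.
-/

set_option autoImplicit false
-- lint debt (one line): the D-0017 layout `Summits/<S>/<S>/Theorems` forces the duplicated namespace segment.
set_option linter.dupNamespace false

namespace Summit.BirchSwinnertonDyer.BirchSwinnertonDyer.Theorems.DefectPrime

open Polynomial

/-! ### §1 `Φ_n(X²) = Φ_n(X)·Φ_{2n}(X)` for odd `n`, at `X = 1 + T` -/

/-- For odd `n`, `Φ_n(X²) = Φ_n(X)·Φ_{2n}(X)` (Mathlib `cyclotomic_expand_eq_cyclotomic_mul` at `2`). [folklore] -/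
theorem cyclotomic_comp_X_sq {R : Type*} [CommRing R] {n : ℕ} (hn : Odd n) :
    (cyclotomic n R).comp (X ^ 2) = cyclotomic n R * cyclotomic (2 * n) R := by
  have h := cyclotomic_expand_eq_cyclotomic_mul Nat.prime_two hn.not_two_dvd_nat R
  rw [expand_eq_comp_X_pow] at h
  rw [h, mul_comm n 2, mul_comm]

/-- **MEMO-17 §2, «`1 + T_v = (1 + T_−)²`» step**: for odd `n`,
`Φ_n((1+T)²) = Φ_n(1+T) · Φ_{2n}(1+T)` in `R[T]`. [folklore] -/
theorem cyclotomic_comp_X_add_one_sq {R : Type*} [CommRing R] {n : ℕ} (hn : Odd n) :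
    (cyclotomic n R).comp ((X + 1) ^ 2) =
      (cyclotomic n R).comp (X + 1) * (cyclotomic (2 * n) R).comp (X + 1) := by
  have h := congr_arg (fun q : R[X] => q.comp (X + 1)) (cyclotomic_comp_X_sq (R := R) hn)
  simp only [comp_assoc, X_pow_comp, mul_comp] at h
  exact h

/-! ### §2 the unit factor `Φ_{2p^i}(1+T)` in `R⟦T⟧` -/

/-- `2·p^(i+1)` is not a prime power when `p` is an odd prime. [folklore] -/
theorem not_prime_pow_two_mul_pow {p : ℕ} (hp : p.Prime) (hp2 : p ≠ 2) (i : ℕ) :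
    ∀ {q : ℕ}, q.Prime → ∀ k : ℕ, q ^ k ≠ 2 * p ^ (i + 1) := by
  intro q hq k hk
  have hpq : p ∣ q := hp.dvd_of_dvd_pow (n := k)
    (hk ▸ dvd_mul_of_dvd_right (dvd_pow_self p (Nat.succ_ne_zero i)) 2)
  have h2q : 2 ∣ q := Nat.prime_two.dvd_of_dvd_pow (n := k) (hk ▸ dvd_mul_right 2 _)
  exact hp2 (((Nat.prime_dvd_prime_iff_eq hp hq).mp hpq).trans
    ((Nat.prime_dvd_prime_iff_eq Nat.prime_two hq).mp h2q).symm)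

/-- `Φ_{2p^(i+1)}(1) = 1` for an odd prime `p`. [folklore] -/
theorem eval_one_cyclotomic_two_mul_pow {R : Type*} [CommRing R] {p : ℕ} (hp : p.Prime) (hp2 : p ≠ 2)
    (i : ℕ) : eval 1 (cyclotomic (2 * p ^ (i + 1)) R) = 1 :=
  eval_one_cyclotomic_not_prime_pow (not_prime_pow_two_mul_pow hp hp2 i)

/-- The constant coefficient of the power series `f(1+T)` is `f(1)`. [folklore] -/
theorem constantCoeff_coe_comp_X_add_one {R : Type*} [CommRing R] (f : R[X]) :
    PowerSeries.constantCoeff ((f.comp (X + 1) : R[X]) : PowerSeries R) = eval 1 f := by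
  rw [Polynomial.constantCoeff_coe, coeff_zero_eq_eval_zero, eval_comp]
  simp

/-- **MEMO-17 §2: «`Φ_{2p^i}(1+T_−)` a UNIT (constant term `Φ_{2p^i}(1) = 1`)»** — in `R⟦T⟧` for any
commutative ring `R` and any odd prime `p`. [folklore] -/
theorem isUnit_coe_cyclotomic_two_mul_comp {R : Type*} [CommRing R] {p : ℕ} (hp : p.Prime) (hp2 : p ≠ 2)
    (i : ℕ) : IsUnit (((cyclotomic (2 * p ^ (i + 1)) R).comp (X + 1) : R[X]) : PowerSeries R) := by
  rw [PowerSeries.isUnit_iff_constantCoeff, constantCoeff_coe_comp_X_add_one,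
    eval_one_cyclotomic_two_mul_pow hp hp2 i]
  exact isUnit_one

/-- **MEMO-17 §2: «`(Φ_{p^i}(1+T_v)) = (π_i)`»** — in `R⟦T⟧`, `Φ_{p^(i+1)}((1+T)²) = π · u` with
`π = Φ_{p^(i+1)}(1+T)` and `u = Φ_{2p^(i+1)}(1+T)` a unit. [folklore] -/
theorem coe_cyclotomic_comp_sq_eq_mul_unit {R : Type*} [CommRing R] {p : ℕ} (hp : p.Prime) (hp2 : p ≠ 2)
    (i : ℕ) : ∃ u : PowerSeries R, IsUnit u ∧
      (((cyclotomic (p ^ (i + 1)) R).comp ((X + 1) ^ 2) : R[X]) : PowerSeries R) =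
        (((cyclotomic (p ^ (i + 1)) R).comp (X + 1) : R[X]) : PowerSeries R) * u := by
  refine ⟨(((cyclotomic (2 * p ^ (i + 1)) R).comp (X + 1) : R[X]) : PowerSeries R),
    isUnit_coe_cyclotomic_two_mul_comp hp hp2 i, ?_⟩
  rw [cyclotomic_comp_X_add_one_sq ((hp.odd_of_ne_two hp2).pow (n := i + 1)), Polynomial.coe_mul]

/-- The two principal ideals agree: `(Φ_{p^(i+1)}((1+T)²)) = (Φ_{p^(i+1)}(1+T))` in `R⟦T⟧`. [folklore] -/
theorem span_coe_cyclotomic_comp_sq {R : Type*} [CommRing R] {p : ℕ} (hp : p.Prime) (hp2 : p ≠ 2)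
    (i : ℕ) : Ideal.span {(((cyclotomic (p ^ (i + 1)) R).comp ((X + 1) ^ 2) : R[X]) : PowerSeries R)} =
      Ideal.span {(((cyclotomic (p ^ (i + 1)) R).comp (X + 1) : R[X]) : PowerSeries R)} := by
  obtain ⟨u, hu, h⟩ := coe_cyclotomic_comp_sq_eq_mul_unit (R := R) hp hp2 i
  rw [h]
  exact Ideal.span_singleton_mul_right_unit hu _

/-! ### §3 `π = Φ_{p^(i+1)}(1+T)` is distinguished at `(p)`: `μ = 0`, `λ = φ(p^(i+1))`, `π(0) = p` -/

/-- `Φ_{p^(i+1)}(1+T) ∈ R[T]` is the base change of the integral polynomial. [folklore] -/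
theorem map_cyclotomic_comp_X_add_one {R : Type*} [CommRing R] (n : ℕ) :
    ((cyclotomic n ℤ).comp (X + 1)).map (Int.castRingHom R) = (cyclotomic n R).comp (X + 1) := by
  rw [map_comp, map_cyclotomic]
  simp

/-- `deg Φ_n(1+T) = φ(n)` over a nontrivial ring. [folklore] -/
theorem natDegree_cyclotomic_comp {R : Type*} [CommRing R] [Nontrivial R] (n : ℕ) :
    ((cyclotomic n R).comp (X + 1)).natDegree = n.totient := by
  rw [← C_1, ← taylor_apply, natDegree_taylor, natDegree_cyclotomic]

/-- `Φ_n(1+T)` is monic. [folklore] -/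
theorem monic_cyclotomic_comp {R : Type*} [CommRing R] (n : ℕ) : ((cyclotomic n R).comp (X + 1)).Monic := by
  rw [← C_1]
  exact (cyclotomic.monic n R).comp_X_add_C 1

/-- **MEMO-17 §2: «`π_i` a distinguished element … (Eisenstein)»** — `Φ_{p^(i+1)}(1+T)` is DISTINGUISHED at the
ideal `(p)` of any commutative ring `R`: monic with all lower coefficients in `(p)` (transport of Mathlib's
`cyclotomic_prime_pow_comp_X_add_one_isEisensteinAt` along `ℤ → R`). [folklore] -/
theorem cyclotomic_comp_isDistinguishedAt {R : Type*} [CommRing R] (p : ℕ) [hp : Fact p.Prime] (i : ℕ) :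
    ((cyclotomic (p ^ (i + 1)) R).comp (X + 1)).IsDistinguishedAt (Ideal.span {(p : R)}) := by
  have hE := (cyclotomic_prime_pow_comp_X_add_one_isEisensteinAt p i).isWeaklyEisensteinAt.map
    (Int.castRingHom R)
  rw [map_cyclotomic_comp_X_add_one] at hE
  have hI : Ideal.map (Int.castRingHom R) (Submodule.span ℤ {(p : ℤ)}) = Ideal.span {(p : R)} := by
    change Ideal.map (Int.castRingHom R) (Ideal.span {(p : ℤ)}) = _
    rw [Ideal.map_span, Set.image_singleton, map_natCast]
  rw [hI] at hE
  exact ⟨hE, monic_cyclotomic_comp _⟩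

/-- **«`μ(π_i) = 0`, `λ(π_i) = φ(p^i)`»**: modulo `p`, `Φ_{p^(i+1)}(1+T) ≡ T^{φ(p^(i+1))}`. [folklore] -/
theorem map_cyclotomic_comp_eq_X_pow {R : Type*} [CommRing R] [Nontrivial R] (p : ℕ) [Fact p.Prime] (i : ℕ) :
    ((cyclotomic (p ^ (i + 1)) R).comp (X + 1)).map (Ideal.Quotient.mk (Ideal.span {(p : R)})) =
      X ^ (p ^ (i + 1)).totient := by
  rw [(cyclotomic_comp_isDistinguishedAt (R := R) p i).map_eq_X_pow, natDegree_cyclotomic_comp]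

/-- `λ(π_i) = φ(p^(i+1)) = p^i (p − 1) > 0`. [folklore] -/
theorem totient_prime_pow_succ_pos {p : ℕ} (hp : p.Prime) (i : ℕ) : 0 < (p ^ (i + 1)).totient :=
  Nat.totient_pos.mpr (pow_pos hp.pos _)

/-- **MEMO-17 §2, (S6)–(S9): «`π_i ↦ π_i(0) = Φ_{p^i}(1) = p`»** — the descent of `π_i` to the line `T = 0`
(`PowerSeries.constantCoeff`) is `p`. [folklore] -/
theorem constantCoeff_coe_cyclotomic_comp {R : Type*} [CommRing R] (p : ℕ) [Fact p.Prime] (i : ℕ) :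
    PowerSeries.constantCoeff ((((cyclotomic (p ^ (i + 1)) R).comp (X + 1) : R[X])) : PowerSeries R) =
      (p : R) := by
  rw [constantCoeff_coe_comp_X_add_one, eval_one_cyclotomic_prime_pow]

/-- **MEMO-17 §2, (S6)–(S9): «the defect becomes the `μ`-TYPE constant `p^{Σe_i}`»** — the descent of
`∏ π_i^{e_i}` to the line `T = 0` is `p^{Σ e_i}`. [folklore] -/
theorem constantCoeff_prod_pow {R : Type*} [CommRing R] (p : ℕ) [Fact p.Prime] (s : Finset ℕ) (e : ℕ → ℕ) :
    PowerSeries.constantCoeff (∏ i ∈ s,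
        ((((cyclotomic (p ^ (i + 1)) R).comp (X + 1) : R[X])) : PowerSeries R) ^ e i) =
      (p : R) ^ (∑ i ∈ s, e i) := by
  rw [map_prod]
  simp_rw [map_pow, constantCoeff_coe_cyclotomic_comp]
  exact Finset.prod_pow_eq_pow_sum s e (p : R)

/-- `π_i` is not a unit of `R⟦T⟧` as soon as `p` is not a unit of `R`. [folklore] -/
theorem not_isUnit_coe_cyclotomic_comp {R : Type*} [CommRing R] (p : ℕ) [Fact p.Prime] (i : ℕ)
    (hpR : ¬ IsUnit (p : R)) :
    ¬ IsUnit ((((cyclotomic (p ^ (i + 1)) R).comp (X + 1) : R[X])) : PowerSeries R) := by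
  rw [PowerSeries.isUnit_iff_constantCoeff, constantCoeff_coe_cyclotomic_comp]
  exact hpR

/-! ### §4 `(π_i) ∩ Λ^cyc = 0`: `π_i` divides no nonzero constant (Weierstrass uniqueness) -/

/-- Transfer of the Hausdorff condition `⋂ₙ pⁿR = 0` from `R` to `R⟦T⟧` (coefficientwise;
`(p : R⟦T⟧) = C (p : R)`). [folklore] -/
theorem isHausdorff_span_natCast_powerSeries {R : Type*} [CommRing R] (p : ℕ)
    [h : IsHausdorff (Ideal.span {(p : R)}) R] :
    IsHausdorff (Ideal.span {(p : PowerSeries R)}) (PowerSeries R) := by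
  refine ⟨fun x hx => ?_⟩
  ext k
  rw [map_zero]
  refine IsHausdorff.haus h _ fun n => ?_
  have hn := hx n
  rw [SModEq.zero, smul_eq_mul, Ideal.mul_top, Ideal.span_singleton_pow, Ideal.mem_span_singleton] at hn ⊢
  obtain ⟨y, hy⟩ := hn
  refine ⟨PowerSeries.coeff k y, ?_⟩
  have := congr_arg (PowerSeries.coeff k) hy
  rwa [← Nat.cast_pow, ← map_natCast (PowerSeries.C (R := R)), PowerSeries.coeff_C_mul, Nat.cast_pow] at this

/-- **Weierstrass uniqueness for `π_i`**: over a commutative ring `R` with `⋂ₙ pⁿR = 0`, if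
`π_i = Φ_{p^(i+1)}(1+T)` divides (in `R⟦T⟧`) a polynomial of degree `< φ(p^(i+1))`, that polynomial is `0`
(Mathlib's `PowerSeries.IsWeierstrassDivisorAt.eq_zero_of_mul_eq` for the distinguished polynomial `π_i`).
[folklore] -/
theorem eq_zero_of_dvd_coe {R : Type*} [CommRing R] (p : ℕ) [Fact p.Prime] (i : ℕ)
    [IsHausdorff (Ideal.span {(p : R)}) R] {r : R[X]} (hr : r.degree < ((p ^ (i + 1)).totient : ℕ))
    (hdvd : ((((cyclotomic (p ^ (i + 1)) R).comp (X + 1) : R[X])) : PowerSeries R) ∣ (r : PowerSeries R)) :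
    r = 0 := by
  rcases subsingleton_or_nontrivial R with hR | hR
  · exact Subsingleton.elim _ _
  set g : R[X] := (cyclotomic (p ^ (i + 1)) R).comp (X + 1)
  have hD := cyclotomic_comp_isDistinguishedAt (R := R) p i
  have hI : Ideal.span {(p : R)} ≠ ⊤ := fun htop =>
    haveI : Subsingleton R := (htop ▸ (inferInstance : IsHausdorff (Ideal.span {(p : R)}) R)).subsingleton
    false_of_nontrivial_of_subsingleton R
  obtain ⟨q, hq⟩ := hdvd
  have hord : ((g : PowerSeries R).map (Ideal.Quotient.mk (Ideal.span {(p : R)}))).order.toNat =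
      (p ^ (i + 1)).totient := by
    have h1 : PowerSeries.constantCoeff (1 : PowerSeries R) ∉ Ideal.span {(p : R)} := by
      rw [map_one]
      exact fun h => hI ((Ideal.eq_top_iff_one _).mpr h)
    rw [← hD.coe_natDegree_eq_order_map (g : PowerSeries R) 1 h1 (by rw [mul_one]), natDegree_cyclotomic_comp]
    rfl
  exact ((hD.isWeierstrassDivisorAt hI).eq_zero_of_mul_eq (hord ▸ hr) hq.symm).2

/-- **MEMO-17 §2: «`(π_i) ∩ Λ^cyc = 0`»** — over a commutative ring `R` with `⋂ₙ pⁿR = 0` (e.g. `R = ℤ_p⟦T_+⟧`,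
§5), `π_i = Φ_{p^(i+1)}(1+T)` divides NO nonzero constant `c ∈ R ⊂ R⟦T⟧`. In particular `π_i` is not
inverted by any multiplicative set of nonzero constants (referee c1 to D29-2). [folklore] -/
theorem eq_zero_of_dvd_C {R : Type*} [CommRing R] (p : ℕ) [hp : Fact p.Prime] (i : ℕ)
    [IsHausdorff (Ideal.span {(p : R)}) R] {c : R}
    (hdvd : ((((cyclotomic (p ^ (i + 1)) R).comp (X + 1) : R[X])) : PowerSeries R) ∣ PowerSeries.C c) :
    c = 0 := by
  have hdeg : (C c : R[X]).degree < ((p ^ (i + 1)).totient : ℕ) :=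
    lt_of_le_of_lt degree_C_le (by exact_mod_cast totient_prime_pow_succ_pos hp.out i)
  have h := eq_zero_of_dvd_coe (R := R) p i hdeg (by rwa [Polynomial.coe_C])
  exact C_eq_zero.mp h

/-! ### §5 the `ℤ_p` instances: `Λ = ℤ_p⟦T_+⟧ = IwasawaAlgebra p`, `Λ₂ = Λ⟦T_−⟧ = IwasawaAlgebra₂ p` -/

section PadicInt

open Literature.NumberTheory.EllipticCurves

/-- `⋂ₙ pⁿ ℤ_p = 0`. [folklore] -/
theorem isHausdorff_span_padicInt (p : ℕ) [Fact p.Prime] : IsHausdorff (Ideal.span {(p : ℤ_[p])}) ℤ_[p] := by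
  rw [← PadicInt.maximalIdeal_eq_span_p]
  infer_instance

/-- `⋂ₙ pⁿ Λ = 0` for `Λ = ℤ_p⟦T⟧` (the tree's `IwasawaAlgebra p`). [folklore] -/
theorem isHausdorff_span_iwasawa (p : ℕ) [Fact p.Prime] :
    IsHausdorff (Ideal.span {(p : IwasawaAlgebra p)}) (IwasawaAlgebra p) :=
  haveI := isHausdorff_span_padicInt p
  isHausdorff_span_natCast_powerSeries (R := ℤ_[p]) p

/-- **«`(π_i) ∩ Λ^cyc = 0`» in `Λ₂ = ℤ_p⟦T_+⟧⟦T_−⟧`** (the tree's `IwasawaAlgebra₂ p`, outer variable `T_−`,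
`Λ^cyc = ℤ_p⟦T_+⟧ ↪ Λ₂` by `PowerSeries.C`): for an arbitrary prime `p` and `i ≥ 0`, if
`π_i = Φ_{p^(i+1)}(1 + T_−)` divides the constant `C c`, `c ∈ Λ^cyc`, then `c = 0`. [folklore] -/
theorem eq_zero_of_dvd_C_padicInt₂ (p : ℕ) [Fact p.Prime] (i : ℕ) {c : IwasawaAlgebra p}
    (hdvd : ((((cyclotomic (p ^ (i + 1)) (IwasawaAlgebra p)).comp (X + 1) : (IwasawaAlgebra p)[X])) :
        PowerSeries (IwasawaAlgebra p)) ∣ PowerSeries.C c) :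
    c = 0 :=
  haveI := isHausdorff_span_iwasawa p
  eq_zero_of_dvd_C (R := IwasawaAlgebra p) p i hdvd

/-- `p` is not a unit of `Λ^cyc = ℤ_p⟦T⟧` (Mathlib `PadicInt.p_nonunit` on the constant term). [folklore] -/
theorem not_isUnit_natCast_iwasawa (p : ℕ) [Fact p.Prime] : ¬ IsUnit (p : IwasawaAlgebra p) := by
  rw [← map_natCast (PowerSeries.C (R := ℤ_[p])) p, PowerSeries.isUnit_iff_constantCoeff,
    PowerSeries.constantCoeff_C]
  exact mem_nonunits_iff.mp PadicInt.p_nonunit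

/-- **«`π_i` not a unit of `Λ₂`»** (`p` is not a unit of `Λ^cyc = ℤ_p⟦T_+⟧`). [folklore] -/
theorem not_isUnit_coe_cyclotomic_comp_padicInt₂ (p : ℕ) [Fact p.Prime] (i : ℕ) :
    ¬ IsUnit ((((cyclotomic (p ^ (i + 1)) (IwasawaAlgebra p)).comp (X + 1) : (IwasawaAlgebra p)[X])) :
        PowerSeries (IwasawaAlgebra p)) :=
  not_isUnit_coe_cyclotomic_comp (R := IwasawaAlgebra p) p i (not_isUnit_natCast_iwasawa p)

/-- **«on the cyclotomic line the defect becomes `p^{Σ e_i}`» in `Λ₂`**: the descent `T_− = 0`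
(`PowerSeries.constantCoeff : Λ₂ → Λ^cyc`) of `∏ π_i^{e_i}` is the constant `p^{Σ e_i} ∈ Λ^cyc`. [folklore] -/
theorem constantCoeff_prod_pow_padicInt₂ (p : ℕ) [Fact p.Prime] (s : Finset ℕ) (e : ℕ → ℕ) :
    PowerSeries.constantCoeff (∏ i ∈ s,
        ((((cyclotomic (p ^ (i + 1)) (IwasawaAlgebra p)).comp (X + 1) : (IwasawaAlgebra p)[X])) :
          PowerSeries (IwasawaAlgebra p)) ^ e i) =
      (p : IwasawaAlgebra p) ^ (∑ i ∈ s, e i) :=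
  constantCoeff_prod_pow (R := IwasawaAlgebra p) p s e

end PadicInt

/-! ### §6 referee c1 (to D29-2), element form: `π_i` is NOT inverted in `Λ₂[(Λ^cyc ∖ 0)⁻¹]` -/

/-- `C` maps non-zero-divisors of `R` to non-zero-divisors of `R⟦T⟧` (coefficientwise). [folklore] -/
theorem map_C_le_nonZeroDivisors {R : Type*} [CommRing R] :
    (nonZeroDivisors R).map (PowerSeries.C (R := R)).toMonoidHom ≤ nonZeroDivisors (PowerSeries R) := by
  rintro _ ⟨s, hs, rfl⟩
  refine (mem_nonZeroDivisors_iff_right).mpr fun f hf => ?_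
  ext k
  have hk := congr_arg (PowerSeries.coeff k) hf
  rw [RingHom.toMonoidHom_eq_coe, MonoidHom.coe_coe, mul_comm, PowerSeries.coeff_C_mul, map_zero] at hk
  rw [map_zero]
  exact (mem_nonZeroDivisors_iff_right.mp hs) _ (by rwa [mul_comm] at hk)

/-- **Referee c1 to the planner's D29-2 («`Φ_{p^i}(1+T_v)` is a UNIT of `Λ_L ⊗_{Λ^cyc} Frac(Λ^cyc)`» — FALSE), element
form**: over a domain `R` with `⋂ₙ pⁿR = 0` (the constants `Λ^cyc`), in ANY localisation `S` of `R⟦T_−⟧` at the nonzero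
constants `C(R ∖ 0)` the image of `π_i = Φ_{p^(i+1)}(1+T_−)` is NOT a unit — a unit would give `π_i · x = C s` with
`s ≠ 0`, against §4. (MEMO-17 §2 (S3), «`P_i` SURVIVES in `R₁`».) [folklore] -/
theorem not_isUnit_algebraMap_localization {R : Type*} [CommRing R] [IsDomain R] (p : ℕ) [Fact p.Prime] (i : ℕ)
    [IsHausdorff (Ideal.span {(p : R)}) R] (S : Type*) [CommRing S] [Algebra (PowerSeries R) S]
    [IsLocalization ((nonZeroDivisors R).map (PowerSeries.C (R := R)).toMonoidHom) S] :
    ¬ IsUnit (algebraMap (PowerSeries R) S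
      ((((cyclotomic (p ^ (i + 1)) R).comp (X + 1) : R[X])) : PowerSeries R)) := by
  set g : PowerSeries R := ((((cyclotomic (p ^ (i + 1)) R).comp (X + 1) : R[X])) : PowerSeries R)
  intro hu
  obtain ⟨w, hw⟩ := hu.exists_right_inv
  obtain ⟨⟨x, m⟩, hxm⟩ := IsLocalization.surj ((nonZeroDivisors R).map (PowerSeries.C (R := R)).toMonoidHom) w
  have h1 : algebraMap (PowerSeries R) S (m : PowerSeries R) = algebraMap (PowerSeries R) S (g * x) := by
    rw [map_mul, ← hxm, ← mul_assoc, hw, one_mul]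
  have h2 : (m : PowerSeries R) = g * x := IsLocalization.injective S (map_C_le_nonZeroDivisors (R := R)) h1
  obtain ⟨s, hs, hsm⟩ := m.2
  exact nonZeroDivisors.ne_zero hs (eq_zero_of_dvd_C (R := R) p i ⟨x, hsm.trans h2⟩)

/-! ### §7 in the tree's vocabulary (`Λ = IwasawaAlgebra p = ℤ_p⟦T⟧`, `X1.MuLambda.mu` / `lam`):
`μ(π_i) = 0`, `λ(π_i) = φ(p^(i+1))`, `π_i` PRIME in `Λ^{ac}` -/

section TreeVocabulary

open Literature.NumberTheory.EllipticCurves Summit.BirchSwinnertonDyer.Rank1Residual.X1.MuLambda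

variable (p : ℕ) [hp : Fact p.Prime]

/-- `π_i` is distinguished at the maximal ideal of `ℤ_p` (the tree's Eisenstein fact
`Rank1Residual.Iwasawa.isEisensteinAt_cyclotomic_comp_X_add_one`, weakened, plus monicity). [folklore] -/
theorem cyclotomic_comp_isDistinguishedAt_maximalIdeal (i : ℕ) :
    ((cyclotomic (p ^ (i + 1)) ℤ_[p]).comp (X + 1)).IsDistinguishedAt (IsLocalRing.maximalIdeal ℤ_[p]) :=
  ⟨(Summit.BirchSwinnertonDyer.Rank1Residual.Iwasawa.isEisensteinAt_cyclotomic_comp_X_add_one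
      (p := p) i).isWeaklyEisensteinAt, monic_cyclotomic_comp _⟩

/-- **«`μ(π_i) = 0`, `λ(π_i) = φ(p^i)`» (reduction form)**: `π_i mod p = T^{φ(p^(i+1))}` in `𝔽_p⟦T⟧`
(`red` of `X1.MuLambdaAlgebra`). [folklore] -/
theorem red_coe_cyclotomic_comp (i : ℕ) :
    red ((((cyclotomic (p ^ (i + 1)) ℤ_[p]).comp (X + 1) : ℤ_[p][X])) : IwasawaAlgebra p) =
      PowerSeries.X ^ (p ^ (i + 1)).totient := by
  have h := (cyclotomic_comp_isDistinguishedAt_maximalIdeal p i).map_eq_X_pow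
  rw [natDegree_cyclotomic_comp] at h
  have h' : Polynomial.map (IsLocalRing.residue ℤ_[p]) ((cyclotomic (p ^ (i + 1)) ℤ_[p]).comp (X + 1)) =
      X ^ (p ^ (i + 1)).totient := h
  show PowerSeries.map (IsLocalRing.residue ℤ_[p]) _ = _
  rw [← Polynomial.polynomial_map_coe, h', Polynomial.coe_pow, Polynomial.coe_X]

/-- `π_i ≢ 0 (mod p)`. [folklore] -/
theorem red_coe_cyclotomic_comp_ne_zero (i : ℕ) :
    red ((((cyclotomic (p ^ (i + 1)) ℤ_[p]).comp (X + 1) : ℤ_[p][X])) : IwasawaAlgebra p) ≠ 0 := by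
  rw [red_coe_cyclotomic_comp]
  exact pow_ne_zero _ PowerSeries.X_ne_zero

/-- **MEMO-17 §2: «`μ(π_i) = 0`»** in the tree's `X1.MuLambda.mu`, and `π_i` is its own `p`-free part. [folklore] -/
theorem mu_coe_cyclotomic_comp (i : ℕ) :
    mu ((((cyclotomic (p ^ (i + 1)) ℤ_[p]).comp (X + 1) : ℤ_[p][X])) : IwasawaAlgebra p) = 0 ∧
      pfree ((((cyclotomic (p ^ (i + 1)) ℤ_[p]).comp (X + 1) : ℤ_[p][X])) : IwasawaAlgebra p) =
        ((((cyclotomic (p ^ (i + 1)) ℤ_[p]).comp (X + 1) : ℤ_[p][X])) : IwasawaAlgebra p) :=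
  mu_eq_and_pfree_eq (a := 0) (red_coe_cyclotomic_comp_ne_zero p i) (by rw [pow_zero, map_one, one_mul])

/-- **MEMO-17 §2: «`λ(π_i) = φ(p^i) > 0`»** in the tree's `X1.MuLambda.lam`: `λ(π_i) = φ(p^(i+1)) = p^i (p − 1)`.
[folklore] -/
theorem lam_coe_cyclotomic_comp (i : ℕ) :
    lam ((((cyclotomic (p ^ (i + 1)) ℤ_[p]).comp (X + 1) : ℤ_[p][X])) : IwasawaAlgebra p) =
      (p ^ (i + 1)).totient := by
  rw [lam, (mu_coe_cyclotomic_comp p i).2, red_coe_cyclotomic_comp, PowerSeries.order_X_pow]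
  rfl

/-- `π_i` is prime in the UFD `ℤ_p[T]` (irreducible by Eisenstein — the tree's
`Rank1Residual.Iwasawa.isEisensteinAt_cyclotomic_comp_X_add_one` — and monic hence primitive). [folklore] -/
theorem prime_cyclotomic_comp_polynomial (i : ℕ) : Prime ((cyclotomic (p ^ (i + 1)) ℤ_[p]).comp (X + 1)) := by
  have hirr : Irreducible ((cyclotomic (p ^ (i + 1)) ℤ_[p]).comp (X + 1)) :=
    (Summit.BirchSwinnertonDyer.Rank1Residual.Iwasawa.isEisensteinAt_cyclotomic_comp_X_add_one (p := p) i).irreducible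
      (IsLocalRing.maximalIdeal.isMaximal ℤ_[p]).isPrime (monic_cyclotomic_comp _).isPrimitive
      (by rw [natDegree_cyclotomic_comp]; exact totient_prime_pow_succ_pos hp.out i)
  exact UniqueFactorizationMonoid.irreducible_iff_prime.mp hirr

/-- **MEMO-17 §2: «`π_i` a distinguished IRREDUCIBLE element of `Λ^{ac} = 𝒪⟦T_−⟧` … prime»** for `𝒪 = ℤ_p`: `π_i` is
PRIME in `Λ = ℤ_p⟦T⟧` — `Λ/(π_i) ≅ ℤ_p[T]/(π_i)` by Weierstrass division for the distinguished polynomial `π_i` (Mathlib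
`Polynomial.IsDistinguishedAt.algEquivQuotient` over the complete local ring `ℤ_p`), a domain by the previous lemma.
(The two-variable primality in `Λ_L` is not attempted here.) [folklore] -/
theorem prime_coe_cyclotomic_comp (i : ℕ) :
    Prime ((((cyclotomic (p ^ (i + 1)) ℤ_[p]).comp (X + 1) : ℤ_[p][X])) : IwasawaAlgebra p) := by
  have hD := cyclotomic_comp_isDistinguishedAt_maximalIdeal p i
  have hne0 : (cyclotomic (p ^ (i + 1)) ℤ_[p]).comp (X + 1) ≠ 0 := (monic_cyclotomic_comp _).ne_zero
  have hne : ((((cyclotomic (p ^ (i + 1)) ℤ_[p]).comp (X + 1) : ℤ_[p][X])) : IwasawaAlgebra p) ≠ 0 := by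
    rw [Ne, Polynomial.coe_eq_zero_iff]
    exact hne0
  rw [← Ideal.span_singleton_prime hne, ← Ideal.Quotient.isDomain_iff_prime]
  have hdom : IsDomain (ℤ_[p][X] ⧸ Ideal.span {(cyclotomic (p ^ (i + 1)) ℤ_[p]).comp (X + 1)}) := by
    rw [Ideal.Quotient.isDomain_iff_prime, Ideal.span_singleton_prime hne0]
    exact prime_cyclotomic_comp_polynomial p i
  exact MulEquiv.isDomain (ℤ_[p][X] ⧸ Ideal.span {(cyclotomic (p ^ (i + 1)) ℤ_[p]).comp (X + 1)})
    hD.algEquivQuotient.symm.toMulEquiv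

end TreeVocabulary

end Summit.BirchSwinnertonDyer.BirchSwinnertonDyer.Theorems.DefectPrime
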